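import Mathlib
import Summits.NavierStokesRegularity.NavierStokesRegularity.Theorems.TaoLadderRungTwoBreakBlowupRigidityOnePeriodicClockedFront
import Summits.NavierStokesRegularity.NavierStokesRegularity.Theorems.TaoLadderRungTwoBreakBlowupRigidityOnePeriodicUniformBound
import Summits.NavierStokesRegularity.NavierStokesRegularity.Theses.TaoLadderRungTwoBreak
import HarnessLib

/-!
# ASYMPTOTIC PERIODICITY SUBSTITUTES FOR TYPE I in the route's LIVE consequence-crux: K2ᵛ(1)
  `TaoLadderRungTwoBreak.EternalRigidityViscBddOne` (stmt-NavierStokesRegularity-20420) BY NAME from the TYPE-I-FREE bundle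
  «robust blow-up is a clocked front, asymptotically shift-periodic along its firing centres» — leaf link
  (item of record for this hand: ⟨20206⟩ `BlowupRigidityOne`; `--supports 20206`)

MODEL lattice ODEs only (Tao 2016 §4, §6.4); nothing here is a statement about the Navier–Stokes equations; NO item is
closed. Thin leaf over the route-independent modules `…PeriodicClockedFront` (p820195) and `…PeriodicUniformBound` (p820317).

* `boundedSurvivingEternal_of_periodicClockedFront` — at `a = 1`: clocked front (action ceiling, amplitude ceiling `Bν^j`
  with `(1+ε₀)⁻¹ ≤ ν²`, firing floor + two-sided clock) + asymptotic `(q,T')`-periodicity (`q ≥ 1`, `T' > 0`) ⇒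
  `∃ W, IsEternal ε₀ α W ∧ UniformBound W ∧ EternalSurvivingFwd 1 ε₀ W` — the `UniformBound` that the type-I-free
  extraction alone does not give comes from PERIODICITY (`uniformBound_of_shiftPeriodic`), not from a type-I bound;
* `eternalRigidityViscBddOne_of_periodicClockedFronts` — **⟨20420⟩ BY NAME** (`ν̂ = 0`) from that bundle attached to every
  robust blow-up below threshold: in K2ᵛ(1)'s skeleton the type-I stub (N-39) can be traded for asymptotic periodicity (F3).

HONEST LABEL: both N-39 and (F3) are OPEN (and (F3) is the riskier); this is a logical map entry, not progress on either;
no stub, crux or summit is proved; rung 0.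
-/

noncomputable section

-- the summit and its single sub-problem share the name (CONVENTIONS §1)
set_option linter.dupNamespace false

open Set Filter Topology MeasureTheory

namespace Summit.NavierStokesRegularity.NavierStokesRegularity.Theorems

namespace BlowupRigidityOne

open Literature.Analysis.FluidPDE Literature.Analysis.FluidPDE.TaoCascade
open Summit.NavierStokesRegularity.NavierStokesRegularity.Theses.TaoLadderRungTwoBreak

variable {m : ℕ}

/-- **Bounded surviving admissible eternal solution from a periodic clocked front, NO type I (`a = 1`).**
[cite: Tao2016AveragedNS, §4 Thm. 4.2, (4.8)–(4.10), §6.4; KochNadirashviliSereginSverak2009, Thm 1.1 ff.; cell vocabulary (`IsEternal`, `UniformBound`, `EternalSurvivingFwd`)] -/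
theorem boundedSurvivingEternal_of_periodicClockedFront {ε₀ T A B ν cf κ₁ κ₂ T' : ℝ} (hε : 0 < ε₀) (hT : 0 < T)
    {α : Fin m → Fin m → Fin m → ℤ × ℤ × ℤ → ℝ}
    {X : Fin m → ℤ → ℝ → ℝ} (hC1 : ∀ i n, ContDiffOn ℝ 1 (X i n) (Set.Ico 0 T))
    (hmot : ∀ i n t, 0 ≤ t → t < T → derivWithin (X i n) (Set.Ici 0) t = quadTerm ε₀ α X i n t)
    {W : ℤ → ℝ → Em m}
    (hW : ∀ n σ, W n σ = (bigLam ε₀ ^ n * Real.exp (-σ)) • shellVec X n (T - Real.exp (-σ)))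
    (hact : ∀ k : ℤ, IntegrableOn (fun t => ‖shellVec X k t‖) (Ico 0 T) ∧
      bigLam ε₀ ^ k * (∫ t in Ico 0 T, ‖shellVec X k t‖) ≤ A)
    (hν : 0 < ν) (hν1 : (1 + ε₀)⁻¹ ≤ ν ^ 2)
    (hamp : ∀ (j : ℤ) (t : ℝ), 0 ≤ t → t < T → ‖shellVec X j t‖ ≤ B * ν ^ j)
    {τ : ℕ → ℝ} (hτ : ∀ k : ℕ, 0 ≤ τ k ∧ τ k < T)
    (hfloor : ∀ k : ℕ, cf * (ν ^ 2) ^ k ≤ ‖shellVec X (k : ℤ) (τ k)‖ ^ 2)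
    (hclock₁ : ∀ k : ℕ, κ₁ ≤ (bigLam ε₀ ^ 2 * ν ^ 2) ^ k * (T - τ k) ^ 2)
    (hclock₂ : ∀ k : ℕ, (bigLam ε₀ ^ 2 * ν ^ 2) ^ k * (T - τ k) ^ 2 ≤ κ₂)
    (hcf : 0 < cf) (hκ₁ : 0 < κ₁) (hκ₂ : 0 < κ₂) {q : ℕ} (hq : 0 < q) (hT' : 0 < T')
    (hasym : ∀ (n : ℤ) (σ : ℝ), Tendsto (fun j : ℕ =>
      W (n + q + (j : ℤ)) (σ + q * T' + -Real.log (T - τ j)) - W (n + (j : ℤ)) (σ + -Real.log (T - τ j)))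
        atTop (𝓝 0)) :
    ∃ Wlim : ℤ → ℝ → Em m, IsEternal ε₀ α Wlim ∧ UniformBound Wlim ∧ EternalSurvivingFwd 1 ε₀ Wlim ∧
      (∀ (n : ℤ) (σ : ℝ), Wlim (n + q) σ = Wlim n (σ - q * T')) := by
  have hb : (0 : ℝ) < 1 + ε₀ := by linarith
  have hpw : 1 ≤ physWeight 1 ε₀ * (bigLam ε₀ ^ 2 * ν ^ 2) :=
    physWeight_mul_ge_one_of_surviving hε (a := 1) (by rwa [Real.rpow_neg_one])
  have hq1 : 1 < bigLam ε₀ ^ 2 * ν ^ 2 := by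
    rw [bigLam_sq hε]
    have h4 : (1 : ℝ) < (1 + ε₀) ^ 4 := one_lt_pow₀ (by linarith) (by norm_num)
    have h5 : (1 + ε₀) ^ 4 ≤ (1 + ε₀) ^ 5 * ν ^ 2 := by
      calc (1 + ε₀) ^ 4 = (1 + ε₀) ^ 5 * (1 + ε₀)⁻¹ := by field_simp
        _ ≤ (1 + ε₀) ^ 5 * ν ^ 2 := mul_le_mul_of_nonneg_left hν1 (pow_pos hb 5).le
    exact lt_of_lt_of_le h4 h5
  obtain ⟨Wlim, hEt, hS, hper, -⟩ := periodicSurvivingEternalLimit_of_clockedFront hε hT hC1 hmot hW hact hν hamp hτ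
    hfloor hclock₁ hclock₂ hcf hκ₁ hκ₂ hq1 hpw hasym
  exact ⟨Wlim, hEt, uniformBound_of_shiftPeriodic hEt hq hT' hper, hS, hper⟩

/-- **K2ᵛ(1) `EternalRigidityViscBddOne` (⟨20420⟩) BY NAME from the type-I-free periodic clocked-front bundle** (`ν̂ = 0`).
[cite: Tao2016AveragedNS, §4 Thm. 4.2, §6.4; KochNadirashviliSereginSverak2009, Thm 1.1 ff.; cell vocabulary (`NoGlobalCascade`, `IsEternalVisc`, `UniformBound`, `EternalSurvivingFwd`)] -/
theorem eternalRigidityViscBddOne_of_periodicClockedFronts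
    (H : ∀ R : ℝ, 1 ≤ R → ∃ εs : ℝ, 0 < εs ∧ ∀ ε₀ : ℝ, 0 < ε₀ → ε₀ ≤ εs →
      ∀ (α : (Fin 4 → Fin 4 → Fin 4 → ℤ × ℤ × ℤ → ℝ)) (X₀ : Fin 4 → ℝ),
        InTableClass R α → NoGlobalCascade ε₀ α X₀ →
        ∃ (T A B ν cf κ₁ κ₂ T' : ℝ) (q : ℕ) (X : Fin 4 → ℤ → ℝ → ℝ) (W : ℤ → ℝ → Em 4) (τ : ℕ → ℝ),
          0 < T ∧
          (∀ i n, ContDiffOn ℝ 1 (X i n) (Set.Ico 0 T)) ∧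
          (∀ i n t, 0 ≤ t → t < T → derivWithin (X i n) (Set.Ici 0) t = quadTerm ε₀ α X i n t) ∧
          (∀ n σ, W n σ = (bigLam ε₀ ^ n * Real.exp (-σ)) • shellVec X n (T - Real.exp (-σ))) ∧
          (∀ k : ℤ, IntegrableOn (fun t => ‖shellVec X k t‖) (Ico 0 T) ∧
            bigLam ε₀ ^ k * (∫ t in Ico 0 T, ‖shellVec X k t‖) ≤ A) ∧
          0 < ν ∧ (1 + ε₀)⁻¹ ≤ ν ^ 2 ∧
          (∀ (j : ℤ) (t : ℝ), 0 ≤ t → t < T → ‖shellVec X j t‖ ≤ B * ν ^ j) ∧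
          (∀ k : ℕ, 0 ≤ τ k ∧ τ k < T) ∧
          (∀ k : ℕ, cf * (ν ^ 2) ^ k ≤ ‖shellVec X (k : ℤ) (τ k)‖ ^ 2) ∧
          (∀ k : ℕ, κ₁ ≤ (bigLam ε₀ ^ 2 * ν ^ 2) ^ k * (T - τ k) ^ 2) ∧
          (∀ k : ℕ, (bigLam ε₀ ^ 2 * ν ^ 2) ^ k * (T - τ k) ^ 2 ≤ κ₂) ∧
          0 < cf ∧ 0 < κ₁ ∧ 0 < κ₂ ∧ 0 < q ∧ 0 < T' ∧
          (∀ (n : ℤ) (σ : ℝ), Tendsto (fun j : ℕ =>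
            W (n + q + (j : ℤ)) (σ + q * T' + -Real.log (T - τ j)) - W (n + (j : ℤ)) (σ + -Real.log (T - τ j)))
              atTop (𝓝 0))) :
    EternalRigidityViscBddOne := by
  intro R hR
  obtain ⟨εs, hεs, hH⟩ := H R hR
  refine ⟨εs, hεs, fun ε₀ hε hεle α X₀ hα hNG => ?_⟩
  obtain ⟨T, A, B, ν, cf, κ₁, κ₂, T', q, X, W, τ, hT, hC1, hmot, hW, hact, hν, hν1, hamp, hτ, hfloor, hclock₁, hclock₂,
    hcf, hκ₁, hκ₂, hq, hT', hasym⟩ := hH ε₀ hε hεle α X₀ hα hNG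
  obtain ⟨Wlim, hEt, hU, hS, -⟩ := boundedSurvivingEternal_of_periodicClockedFront hε hT hC1 hmot hW hact hν hν1 hamp hτ
    hfloor hclock₁ hclock₂ hcf hκ₁ hκ₂ hq hT' hasym
  exact ⟨0, Wlim, hEt.isEternalVisc, hU, hS⟩

end BlowupRigidityOne

end Summit.NavierStokesRegularity.NavierStokesRegularity.Theorems

end
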